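import Summits.QuantumFields.BalabanUV.Beta.EriceRemainderEnclosureHistoryAutonomyOrder

/-!
# EriceRemainderEnclosureHistoryAutonomyOrderScreening — (E48c) ISOTONE MEMORY SCREENS, ANTITONE MEMORY ANTI-SCREENS THE INFRARED DIFFERENCE: for a functional
# NON-DECREASING in the history (zeroth moment `M` of ANY size, floor `b > 0` on ]0,γ]) two box solutions `h, h′` from pins `t ≤ t′` are ordered ((E48a)) and their
# recursion-variable discrepancy `δ_j = 1∕h_j² − 1∕h′_j²` is NON-INCREASING in the scale: `e^{−3M∕(2b√b)}·δ_0 ≤ δ_j ≤ δ_0 = 1∕t² − 1∕t′²` — so for ANY two pins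
# `|1∕h_j² − 1∕h′_j²| ≤ |1∕t² − 1∕t′²|` and `|h_j − h′_j| ≤ (1∕γ² + j·b)^{−3∕2}∕2·|1∕t² − 1∕t′²|` at EVERY scale, UNIFORMLY IN `M`: isotone memory of any size is
# Lipschitz-stable in the pin with the MEMORYLESS constant ((E38b)'s `1∕(1 − q)` is not needed), the discrepancy converges, and a fraction `≥ e^{−3M∕(2b√b)}`
# of the infrared difference survives to the ultraviolet; for a functional NON-INCREASING in the history, in any uniqueness regime, `δ_j` is NON-DECREASING:
# `|1∕h_j² − 1∕h′_j²| ≥ |1∕t² − 1∕t′²|` — the trajectories separate in the recursion variable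

Cell `pub-balaban`, β-function sub-cell, BINDER row D4 «RemainderConst leaves for Bałaban's split» (`HOME/BINDER-OWNERS.md`; owner lineage `b2b-balaban-beta-an4`;
this file by co-owner #2 lineage `b2b-balaban-beta-d4-p2`, generation 45), β-FLOW TEAM duty (1), FREEZE (0) honoured (def-free; node U2's `MemFlow` ∕ `SeqBox` ∕
`memFlow_sq_le` ∕ `Sharpness.abs_sub_le_half_cube_mul`, (E38a)'s `le_inv_sqrt_of_le_inv_sq`, (E43b)'s `memFlow_unique_of_monotone_zm` ∕ `prod_le_exp`, (E48a)'s
`le_of_pin_le` ∕ `lt_of_pin_lt` BY NAME).  Sequel of (E48a) `…HistoryAutonomyOrder` (imported) and (E43b) `…HistoryAutonomyMonotoneGeneral`.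

HONEST FRAMING (page 1, verbatim and binding).  *"Discharging BetaPertH makes Bałaban's UV stability UNCONDITIONAL — a real constructive-QFT result; it is
NOT the continuum limit and NOT the Clay problem."*  THIS FILE DISCHARGES NOTHING OF THE KIND.  Pure real analysis about an ABSTRACT functional with displayed
zeroth moment, floor and SIGN of its dependence on the history — hypotheses, not facts; the sign of the dependence of Bałaban's `β_{k+1}` on the preceding
couplings is NOT PRINTED ([I] p. 298 qualitative; GAPS G-t4-U2-1∕-2) and not asserted.  Row D4 class UNCHANGED (critical-path width 0; instance 0∕1; D4 DISCHARGE
NO DATE).  HONEST DEPENDENCY: continuum YM on T⁴ ⇐ BetaPertH ∧ nine spine estimates (0/9 proved); BetaPertH ⇐ (D1) ∧ (D4) ∧ CAP+tail; G-an2-4 gates asym, D1 and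
NE2/3/4.

THE POINT (census sense (α); the AUTONOMY row — the signed classes, quantitatively).  Once the trajectories are ORDERED ((E48a): uniqueness suffices; (E43b):
isotone memory of any size is a uniqueness regime), the sign of the memory decides the fate of the infrared difference `δ_0 = 1∕t² − 1∕t′²` of two trajectories
`h ≤ h′`: the increment `δ_{j+1} − δ_j = B(h(j+1+·)) − B(h′(j+1+·))` is `≤ 0` for ISOTONE `B` (§1: `δ` non-increasing — the larger trajectory runs with the larger
β-function and catches up in `1∕g²`: SCREENING) and `≥ 0` for ANTITONE `B` (§3: ANTI-SCREENING).  Consequences for isotone memory of ANY size (§§1–2): `0 ≤ δ_j ≤ δ_0`,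
hence for ANY two pins `|1∕h_j² − 1∕h′_j²| ≤ |1∕t² − 1∕t′²|` (`abs_disc_le_of_monotone`) and, through the half-cube sensitivity under the asymptotic-freedom
envelope, `|h_j − h′_j| ≤ (1∕γ² + j·b)^{−3∕2}∕2·|1∕t² − 1∕t′²| ≤ γ³∕2·|1∕t² − 1∕t′²|` (`abs_sub_le_of_monotone`) — LIPSCHITZ STABILITY IN THE PIN, UNIFORM IN THE SCALE
AND IN `M`, with the constant of the MEMORYLESS flow ((E38b) pays `1∕(1 − q)` and needs `q < 1`; (E43b) had uniqueness for isotone memory but no modulus); and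
downwards the screening is INCOMPLETE: `δ_j ≤ (1 + M∕2·c_{j+1}³)·δ_{j+1}` with the envelope `c_i = (1∕t′² + i·b)^{−1∕2}` of the larger pin (the tail discrepancies
are `≤ c_{j+1}³∕2·δ_{j+1}` because `δ` is non-increasing), so `δ_0 ≤ e^{3M∕(2b√b)}·δ_j` ((E43b)'s `prod_le_exp`), `δ_j → δ_∞` with `e^{−3M∕(2b√b)}·δ_0 ≤ δ_∞ ≤ δ_0`
(`tendsto_disc_of_monotone`): two continuum trajectories of an isotone flow with different infrared values keep a DEFINITE FRACTION of their `1∕g²`-offset at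
every scale.  §3: antitone memory in a uniqueness regime (e.g. `M·γ ≤ 3√3·b`): `δ_0 ≤ δ_j ≤ δ_{j+1}`.  NOT claimed: an upper bound for the antitone
discrepancy beyond (E38b)∕(E47a); the sign of Bałaban's memory; anything printed.

WHAT IS PROVED ([folklore]; 0 `def`, 0 sorry).  §1 (isotone, any `M`) `le_of_pin_le_of_monotone_zm`, `disc_nonneg_of_monotone`, **`disc_succ_le_of_monotone`**,
`disc_antitone_of_monotone`, `disc_le_disc_zero_of_monotone`, **`abs_disc_le_of_monotone`**, `le_envelope_of_pin_le`, **`abs_sub_le_of_monotone`**, `abs_sub_le_of_monotone'`.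
§2 `disc_le_mul_disc_succ_of_monotone`, **`disc_zero_le_exp_mul_disc_of_monotone`**, **`tendsto_disc_of_monotone`**.  §3 (antitone, uniqueness regime)
**`disc_le_disc_succ_of_antitone`**, `disc_monotone_of_antitone`, **`disc_zero_le_disc_of_antitone`**, `disc_zero_le_disc_of_antitone_zs_closed`.
-/

noncomputable section
open Filter Topology Finset Set

namespace Summit.QuantumFields.BalabanUV.Beta.EriceRemainderEnclosureHistoryAutonomyOrderScreening

open Literature.MathematicalPhysics.QuantumFieldTheory.Balaban1983to89
open Literature.MathematicalPhysics.QuantumFieldTheory.Balaban1983to89.T4BetaStationary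
open Literature.MathematicalPhysics.QuantumFieldTheory.Balaban1983to89.T4BetaFlowWellPosed
open Literature.MathematicalPhysics.QuantumFieldTheory.Balaban1983to89.T4BetaFlowWellPosed.Sharpness (abs_sub_le_half_cube_mul)
open Summit.QuantumFields.BalabanUV.Beta.EriceRemainderEnclosureHistoryAutonomyThreshold (le_inv_sqrt_of_le_inv_sq memFlow_unique_zs_closed)
open Summit.QuantumFields.BalabanUV.Beta.EriceRemainderEnclosureHistoryAutonomyMonotoneGeneral (memFlow_unique_of_monotone_zm prod_le_exp)
open Summit.QuantumFields.BalabanUV.Beta.EriceRemainderEnclosureHistoryAutonomyOrder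

variable {B : (ℕ → ℝ) → ℝ} {M γ b t t' : ℝ} {h h' : ℕ → ℝ}

/-! ## §1 Isotone memory of any size: the discrepancy is non-increasing — Lipschitz stability in the pin with the memoryless constant -/

/-- WEAK ORDER for isotone memory of any size: pins `t ≤ t′` give `h j ≤ h′ j` ((E48a) `le_of_pin_le` with (E43b)'s uniqueness). [folklore] -/
theorem le_of_pin_le_of_monotone_zm (hb : 0 < b)
    (hmono : ∀ u v : ℕ → ℝ, SeqBox γ u → SeqBox γ v → (∀ j, u j ≤ v j) → B u ≤ B v)
    (hB : ∀ u u' : ℕ → ℝ, SeqBox γ u → SeqBox γ u' → ∀ D : ℝ, (∀ j, |u j - u' j| ≤ D) → |B u - B u'| ≤ M * D)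
    (hM : 0 ≤ M) (hlo : ∀ u, SeqBox γ u → b ≤ B u) (ht : 0 < t) (htt' : t ≤ t') (ht'γ : t' ≤ γ)
    (hh : SeqBox γ h) (hh' : SeqBox γ h') (hf : MemFlow B t h) (hf' : MemFlow B t' h') (j : ℕ) : h j ≤ h' j :=
  le_of_pin_le hb hB hM hlo (fun _ hp0 _ _ _ hu hu' hfu hfu' => memFlow_unique_of_monotone_zm hmono hB hM hp0 hb hlo hu hu' hfu hfu')
    ht htt' ht'γ hh hh' hf hf' j

/-- Hence the recursion-variable discrepancy is NONNEGATIVE: `0 ≤ 1∕h_j² − 1∕h′_j²`. [folklore] -/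
theorem disc_nonneg_of_monotone (hb : 0 < b)
    (hmono : ∀ u v : ℕ → ℝ, SeqBox γ u → SeqBox γ v → (∀ j, u j ≤ v j) → B u ≤ B v)
    (hB : ∀ u u' : ℕ → ℝ, SeqBox γ u → SeqBox γ u' → ∀ D : ℝ, (∀ j, |u j - u' j| ≤ D) → |B u - B u'| ≤ M * D)
    (hM : 0 ≤ M) (hlo : ∀ u, SeqBox γ u → b ≤ B u) (ht : 0 < t) (htt' : t ≤ t') (ht'γ : t' ≤ γ)
    (hh : SeqBox γ h) (hh' : SeqBox γ h') (hf : MemFlow B t h) (hf' : MemFlow B t' h') (j : ℕ) : 0 ≤ 1 / h j ^ 2 - 1 / h' j ^ 2 :=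
  sub_nonneg.2 (one_div_le_one_div_of_le (pow_pos (hh j).1 2)
    (pow_le_pow_left₀ (hh j).1.le (le_of_pin_le_of_monotone_zm hb hmono hB hM hlo ht htt' ht'γ hh hh' hf hf' j) 2))

/-- **SCREENING**: for ISOTONE memory the discrepancy is NON-INCREASING in the scale, `δ_{j+1} ≤ δ_j` — the increment is `B(h(j+1+·)) − B(h′(j+1+·)) ≤ 0`
because the tails are ordered. [folklore] -/
theorem disc_succ_le_of_monotone (hb : 0 < b)
    (hmono : ∀ u v : ℕ → ℝ, SeqBox γ u → SeqBox γ v → (∀ j, u j ≤ v j) → B u ≤ B v)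
    (hB : ∀ u u' : ℕ → ℝ, SeqBox γ u → SeqBox γ u' → ∀ D : ℝ, (∀ j, |u j - u' j| ≤ D) → |B u - B u'| ≤ M * D)
    (hM : 0 ≤ M) (hlo : ∀ u, SeqBox γ u → b ≤ B u) (ht : 0 < t) (htt' : t ≤ t') (ht'γ : t' ≤ γ)
    (hh : SeqBox γ h) (hh' : SeqBox γ h') (hf : MemFlow B t h) (hf' : MemFlow B t' h') (j : ℕ) :
    1 / h (j + 1) ^ 2 - 1 / h' (j + 1) ^ 2 ≤ 1 / h j ^ 2 - 1 / h' j ^ 2 := by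
  have hle : B (fun i => h (j + 1 + i)) ≤ B (fun i => h' (j + 1 + i)) :=
    hmono _ _ (seqBox_shift hh (j + 1)) (seqBox_shift hh' (j + 1))
      fun i => le_of_pin_le_of_monotone_zm hb hmono hB hM hlo ht htt' ht'γ hh hh' hf hf' (j + 1 + i)
  rw [hf.2 j, hf'.2 j]; linarith

/-- So the discrepancy is an ANTITONE sequence … [folklore] -/
theorem disc_antitone_of_monotone (hb : 0 < b)
    (hmono : ∀ u v : ℕ → ℝ, SeqBox γ u → SeqBox γ v → (∀ j, u j ≤ v j) → B u ≤ B v)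
    (hB : ∀ u u' : ℕ → ℝ, SeqBox γ u → SeqBox γ u' → ∀ D : ℝ, (∀ j, |u j - u' j| ≤ D) → |B u - B u'| ≤ M * D)
    (hM : 0 ≤ M) (hlo : ∀ u, SeqBox γ u → b ≤ B u) (ht : 0 < t) (htt' : t ≤ t') (ht'γ : t' ≤ γ)
    (hh : SeqBox γ h) (hh' : SeqBox γ h') (hf : MemFlow B t h) (hf' : MemFlow B t' h') :
    Antitone fun j => 1 / h j ^ 2 - 1 / h' j ^ 2 :=
  antitone_nat_of_succ_le fun j => disc_succ_le_of_monotone hb hmono hB hM hlo ht htt' ht'γ hh hh' hf hf' j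

/-- … bounded by its infrared value: `1∕h_j² − 1∕h′_j² ≤ 1∕t² − 1∕t′²`. [folklore] -/
theorem disc_le_disc_zero_of_monotone (hb : 0 < b)
    (hmono : ∀ u v : ℕ → ℝ, SeqBox γ u → SeqBox γ v → (∀ j, u j ≤ v j) → B u ≤ B v)
    (hB : ∀ u u' : ℕ → ℝ, SeqBox γ u → SeqBox γ u' → ∀ D : ℝ, (∀ j, |u j - u' j| ≤ D) → |B u - B u'| ≤ M * D)
    (hM : 0 ≤ M) (hlo : ∀ u, SeqBox γ u → b ≤ B u) (ht : 0 < t) (htt' : t ≤ t') (ht'γ : t' ≤ γ)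
    (hh : SeqBox γ h) (hh' : SeqBox γ h') (hf : MemFlow B t h) (hf' : MemFlow B t' h') (j : ℕ) :
    1 / h j ^ 2 - 1 / h' j ^ 2 ≤ 1 / t ^ 2 - 1 / t' ^ 2 := by
  have := disc_antitone_of_monotone hb hmono hB hM hlo ht htt' ht'γ hh hh' hf hf' (Nat.zero_le j)
  simp only at this
  rwa [hf.1, hf'.1] at this

/-- **ISOTONE MEMORY OF ANY SIZE IS LIPSCHITZ-STABLE IN THE PIN, IN THE RECURSION VARIABLE WITH CONSTANT ONE**: for ANY two pins `t, t′ ∈ ]0,γ]` and their box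
solutions, `|1∕h_j² − 1∕h′_j²| ≤ |1∕t² − 1∕t′²|` at every scale — uniformly in `M` (no threshold, no `1∕(1 − q)`). [folklore] -/
theorem abs_disc_le_of_monotone (hb : 0 < b)
    (hmono : ∀ u v : ℕ → ℝ, SeqBox γ u → SeqBox γ v → (∀ j, u j ≤ v j) → B u ≤ B v)
    (hB : ∀ u u' : ℕ → ℝ, SeqBox γ u → SeqBox γ u' → ∀ D : ℝ, (∀ j, |u j - u' j| ≤ D) → |B u - B u'| ≤ M * D)
    (hM : 0 ≤ M) (hlo : ∀ u, SeqBox γ u → b ≤ B u) (ht : 0 < t) (htγ : t ≤ γ) (ht' : 0 < t') (ht'γ : t' ≤ γ)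
    (hh : SeqBox γ h) (hh' : SeqBox γ h') (hf : MemFlow B t h) (hf' : MemFlow B t' h') (j : ℕ) :
    |1 / h j ^ 2 - 1 / h' j ^ 2| ≤ |1 / t ^ 2 - 1 / t' ^ 2| := by
  rcases le_total t t' with hle | hle
  · rw [abs_of_nonneg (disc_nonneg_of_monotone hb hmono hB hM hlo ht hle ht'γ hh hh' hf hf' j),
      abs_of_nonneg (disc_nonneg_of_monotone hb hmono hB hM hlo ht hle ht'γ hh hh' hf hf' 0 |>.trans_eq (by rw [hf.1, hf'.1]))]
    exact disc_le_disc_zero_of_monotone hb hmono hB hM hlo ht hle ht'γ hh hh' hf hf' j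
  · rw [abs_sub_comm, abs_sub_comm (1 / t ^ 2),
      abs_of_nonneg (disc_nonneg_of_monotone hb hmono hB hM hlo ht' hle htγ hh' hh hf' hf j),
      abs_of_nonneg (disc_nonneg_of_monotone hb hmono hB hM hlo ht' hle htγ hh' hh hf' hf 0 |>.trans_eq (by rw [hf.1, hf'.1]))]
    exact disc_le_disc_zero_of_monotone hb hmono hB hM hlo ht' hle htγ hh' hh hf' hf j

/-- THE ENVELOPE OF THE LARGER PIN: a box solution from a pin `t ≤ t′` satisfies `h i ≤ (1∕t′² + i·b)^{−1∕2}` (node U2's `memFlow_sq_le`). [folklore] -/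
theorem le_envelope_of_pin_le (hb : 0 < b) (hlo : ∀ u, SeqBox γ u → b ≤ B u) (ht : 0 < t) (htt' : t ≤ t')
    (hh : SeqBox γ h) (hf : MemFlow B t h) (i : ℕ) : h i ≤ 1 / Real.sqrt (1 / t' ^ 2 + (i : ℝ) * b) := by
  have hP : 0 < 1 / t' ^ 2 + (i : ℝ) * b := by
    have : 0 < t' := ht.trans_le htt'
    have : (0 : ℝ) ≤ (i : ℝ) * b := mul_nonneg (Nat.cast_nonneg i) hb.le
    positivity
  refine le_inv_sqrt_of_le_inv_sq (hh i).1 hP ?_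
  have h1 := memFlow_sq_le hlo hb ht hh hf i
  have h2 : 1 / t' ^ 2 ≤ 1 / t ^ 2 := one_div_le_one_div_of_le (pow_pos ht 2) (pow_le_pow_left₀ ht.le htt' 2)
  have h3 : 0 < 1 / t ^ 2 + (i : ℝ) * b := by linarith
  calc 1 / t' ^ 2 + (i : ℝ) * b ≤ 1 / t ^ 2 + (i : ℝ) * b := by linarith
    _ = 1 / (1 / (1 / t ^ 2 + (i : ℝ) * b)) := by rw [one_div_one_div]
    _ ≤ 1 / h i ^ 2 := one_div_le_one_div_of_le (pow_pos (hh i).1 2) h1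

/-- **ISOTONE MEMORY OF ANY SIZE IS LIPSCHITZ-STABLE IN THE PIN AT EVERY SCALE WITH THE MEMORYLESS CONSTANT**: for ANY two pins in ]0,γ],
`|h_j − h′_j| ≤ (1∕γ² + j·b)^{−3∕2}∕2·|1∕t² − 1∕t′²|` — the half-cube sensitivity under the asymptotic-freedom envelope times the screened discrepancy.
[folklore] -/
theorem abs_sub_le_of_monotone (hb : 0 < b)
    (hmono : ∀ u v : ℕ → ℝ, SeqBox γ u → SeqBox γ v → (∀ j, u j ≤ v j) → B u ≤ B v)
    (hB : ∀ u u' : ℕ → ℝ, SeqBox γ u → SeqBox γ u' → ∀ D : ℝ, (∀ j, |u j - u' j| ≤ D) → |B u - B u'| ≤ M * D)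
    (hM : 0 ≤ M) (hlo : ∀ u, SeqBox γ u → b ≤ B u) (ht : 0 < t) (htγ : t ≤ γ) (ht' : 0 < t') (ht'γ : t' ≤ γ)
    (hh : SeqBox γ h) (hh' : SeqBox γ h') (hf : MemFlow B t h) (hf' : MemFlow B t' h') (j : ℕ) :
    |h j - h' j| ≤ (1 / Real.sqrt (1 / γ ^ 2 + (j : ℝ) * b)) ^ 3 / 2 * |1 / t ^ 2 - 1 / t' ^ 2| :=
  calc |h j - h' j| ≤ (1 / Real.sqrt (1 / γ ^ 2 + (j : ℝ) * b)) ^ 3 / 2 * |1 / h j ^ 2 - 1 / h' j ^ 2| :=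
        abs_sub_le_half_cube_mul (hh j).1 (hh' j).1 (le_envelope_of_pin_le hb hlo ht htγ hh hf j)
          (le_envelope_of_pin_le hb hlo ht' ht'γ hh' hf' j)
    _ ≤ (1 / Real.sqrt (1 / γ ^ 2 + (j : ℝ) * b)) ^ 3 / 2 * |1 / t ^ 2 - 1 / t' ^ 2| :=
        mul_le_mul_of_nonneg_left (abs_disc_le_of_monotone hb hmono hB hM hlo ht htγ ht' ht'γ hh hh' hf hf' j) (by positivity)

/-- … in particular `|h_j − h′_j| ≤ γ³∕2·|1∕t² − 1∕t′²|`, uniformly in the scale and in `M` ((E38b)'s bound without the factor `1∕(1 − q)`). [folklore] -/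
theorem abs_sub_le_of_monotone' (hb : 0 < b)
    (hmono : ∀ u v : ℕ → ℝ, SeqBox γ u → SeqBox γ v → (∀ j, u j ≤ v j) → B u ≤ B v)
    (hB : ∀ u u' : ℕ → ℝ, SeqBox γ u → SeqBox γ u' → ∀ D : ℝ, (∀ j, |u j - u' j| ≤ D) → |B u - B u'| ≤ M * D)
    (hM : 0 ≤ M) (hlo : ∀ u, SeqBox γ u → b ≤ B u) (ht : 0 < t) (htγ : t ≤ γ) (ht' : 0 < t') (ht'γ : t' ≤ γ)
    (hh : SeqBox γ h) (hh' : SeqBox γ h') (hf : MemFlow B t h) (hf' : MemFlow B t' h') (j : ℕ) :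
    |h j - h' j| ≤ γ ^ 3 / 2 * |1 / t ^ 2 - 1 / t' ^ 2| := by
  have hγ : 0 < γ := ht.trans_le htγ
  refine (abs_sub_le_of_monotone hb hmono hB hM hlo ht htγ ht' ht'γ hh hh' hf hf' j).trans
    (mul_le_mul_of_nonneg_right (div_le_div_of_nonneg_right ?_ (by norm_num)) (abs_nonneg _))
  have henv : 1 / Real.sqrt (1 / γ ^ 2 + (j : ℝ) * b) ≤ γ :=
    one_div_sqrt_le hγ (le_add_of_nonneg_right (mul_nonneg (Nat.cast_nonneg j) hb.le))
  exact pow_le_pow_left₀ (by positivity) henv 3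

/-! ## §2 The screening is incomplete: a fraction `e^{−3M∕(2b√b)}` of the infrared difference survives; the discrepancy converges -/

/-- ONE SCALE DOWN: `δ_j ≤ (1 + M∕2·c_{j+1}³)·δ_{j+1}`, `c_i = (1∕t′² + i·b)^{−1∕2}` — the tail discrepancies beyond `j` are `≤ c_{j+1}³∕2·δ_{j+1}` because `δ`
is non-increasing and the couplings sit under the envelope of the larger pin. [folklore] -/
theorem disc_le_mul_disc_succ_of_monotone (hb : 0 < b)
    (hmono : ∀ u v : ℕ → ℝ, SeqBox γ u → SeqBox γ v → (∀ j, u j ≤ v j) → B u ≤ B v)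
    (hB : ∀ u u' : ℕ → ℝ, SeqBox γ u → SeqBox γ u' → ∀ D : ℝ, (∀ j, |u j - u' j| ≤ D) → |B u - B u'| ≤ M * D)
    (hM : 0 ≤ M) (hlo : ∀ u, SeqBox γ u → b ≤ B u) (ht : 0 < t) (htt' : t ≤ t') (ht'γ : t' ≤ γ)
    (hh : SeqBox γ h) (hh' : SeqBox γ h') (hf : MemFlow B t h) (hf' : MemFlow B t' h') (j : ℕ) :
    1 / h j ^ 2 - 1 / h' j ^ 2 ≤
      (1 + M / 2 * (1 / Real.sqrt (1 / t' ^ 2 + ((j : ℝ) + 1) * b)) ^ 3) * (1 / h (j + 1) ^ 2 - 1 / h' (j + 1) ^ 2) := by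
  set c : ℝ := 1 / Real.sqrt (1 / t' ^ 2 + ((j : ℝ) + 1) * b) with hc
  set D : ℝ := c ^ 3 / 2 * (1 / h (j + 1) ^ 2 - 1 / h' (j + 1) ^ 2) with hD
  have ht' : 0 < t' := ht.trans_le htt'
  have hanti := disc_antitone_of_monotone hb hmono hB hM hlo ht htt' ht'γ hh hh' hf hf'
  have hc0 : 0 ≤ c := by rw [hc]; positivity
  -- the tail beyond `j` is entrywise `D`-close
  have htail : ∀ i, |h (j + 1 + i) - h' (j + 1 + i)| ≤ D := by
    intro i
    have hP : 0 < 1 / t' ^ 2 + ((j : ℝ) + 1) * b := by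
      have : (0 : ℝ) ≤ ((j : ℝ) + 1) * b := by positivity
      positivity
    have henv : ∀ {k : ℕ → ℝ} {s : ℝ}, 0 < s → s ≤ t' → SeqBox γ k → MemFlow B s k → k (j + 1 + i) ≤ c := by
      intro k s hs hst' hk hfk
      refine (le_envelope_of_pin_le hb hlo hs hst' hk hfk (j + 1 + i)).trans (one_div_sqrt_anti hP ?_)
      push_cast; nlinarith [(Nat.cast_nonneg i : (0 : ℝ) ≤ i), hb]
    calc |h (j + 1 + i) - h' (j + 1 + i)| ≤ c ^ 3 / 2 * |1 / h (j + 1 + i) ^ 2 - 1 / h' (j + 1 + i) ^ 2| :=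
          abs_sub_le_half_cube_mul (hh _).1 (hh' _).1 (henv ht htt' hh hf) (henv ht' le_rfl hh' hf')
      _ = c ^ 3 / 2 * (1 / h (j + 1 + i) ^ 2 - 1 / h' (j + 1 + i) ^ 2) := by
          rw [abs_of_nonneg (disc_nonneg_of_monotone hb hmono hB hM hlo ht htt' ht'γ hh hh' hf hf' _)]
      _ ≤ D := mul_le_mul_of_nonneg_left (hanti (by omega : j + 1 ≤ j + 1 + i)) (by positivity)
  have hinc : |B (fun i => h (j + 1 + i)) - B (fun i => h' (j + 1 + i))| ≤ M * D :=
    hB _ _ (seqBox_shift hh (j + 1)) (seqBox_shift hh' (j + 1)) D htail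
  have hstep : 1 / h j ^ 2 - 1 / h' j ^ 2 =
      (1 / h (j + 1) ^ 2 - 1 / h' (j + 1) ^ 2) - (B (fun i => h (j + 1 + i)) - B (fun i => h' (j + 1 + i))) := by
    rw [hf.2 j, hf'.2 j]; ring
  rw [hstep]
  have := (abs_sub_le_iff.1 hinc).2
  rw [hD] at this
  nlinarith [this]

/-- **NON-MERGING FOR ISOTONE MEMORY**: `1∕t² − 1∕t′² ≤ e^{3M∕(2b√b)}·(1∕h_j² − 1∕h′_j²)` at every scale — a fraction `≥ e^{−3M∕(2b√b)}` of the infrared difference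
survives the screening ((E43b)'s `prod_le_exp`). [folklore] -/
theorem disc_zero_le_exp_mul_disc_of_monotone (hb : 0 < b)
    (hmono : ∀ u v : ℕ → ℝ, SeqBox γ u → SeqBox γ v → (∀ j, u j ≤ v j) → B u ≤ B v)
    (hB : ∀ u u' : ℕ → ℝ, SeqBox γ u → SeqBox γ u' → ∀ D : ℝ, (∀ j, |u j - u' j| ≤ D) → |B u - B u'| ≤ M * D)
    (hM : 0 ≤ M) (hlo : ∀ u, SeqBox γ u → b ≤ B u) (ht : 0 < t) (htt' : t ≤ t') (ht'γ : t' ≤ γ)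
    (hh : SeqBox γ h) (hh' : SeqBox γ h') (hf : MemFlow B t h) (hf' : MemFlow B t' h') (j : ℕ) :
    1 / t ^ 2 - 1 / t' ^ 2 ≤ Real.exp (3 * M / (2 * (b * Real.sqrt b))) * (1 / h j ^ 2 - 1 / h' j ^ 2) := by
  set f : ℕ → ℝ := fun l => 1 + M / 2 * (1 / Real.sqrt (1 / t' ^ 2 + ((l : ℝ) + 1) * b)) ^ 3 with hfdef
  have hδ0 : ∀ i, 0 ≤ 1 / h i ^ 2 - 1 / h' i ^ 2 := fun i => disc_nonneg_of_monotone hb hmono hB hM hlo ht htt' ht'γ hh hh' hf hf' i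
  have key : ∀ n : ℕ, 1 / h 0 ^ 2 - 1 / h' 0 ^ 2 ≤ (∏ l ∈ Ico 0 n, f l) * (1 / h n ^ 2 - 1 / h' n ^ 2) := by
    intro n
    induction n with
    | zero => simp
    | succ n ih =>
      have hfn : 0 ≤ ∏ l ∈ Ico 0 n, f l := prod_nonneg fun l _ => by rw [hfdef]; positivity
      calc 1 / h 0 ^ 2 - 1 / h' 0 ^ 2 ≤ (∏ l ∈ Ico 0 n, f l) * (1 / h n ^ 2 - 1 / h' n ^ 2) := ih
        _ ≤ (∏ l ∈ Ico 0 n, f l) * (f n * (1 / h (n + 1) ^ 2 - 1 / h' (n + 1) ^ 2)) :=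
            mul_le_mul_of_nonneg_left (disc_le_mul_disc_succ_of_monotone hb hmono hB hM hlo ht htt' ht'γ hh hh' hf hf' n) hfn
        _ = (∏ l ∈ Ico 0 (n + 1), f l) * (1 / h (n + 1) ^ 2 - 1 / h' (n + 1) ^ 2) := by
            rw [Finset.prod_Ico_succ_top (Nat.zero_le n)]; ring
  have h0 : 1 / h 0 ^ 2 - 1 / h' 0 ^ 2 = 1 / t ^ 2 - 1 / t' ^ 2 := by rw [hf.1, hf'.1]
  rw [← h0]
  exact (key j).trans (mul_le_mul_of_nonneg_right (prod_le_exp hb hM t' 0 j) (hδ0 j))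

/-- **THE DISCREPANCY CONVERGES** for isotone memory of any size: `1∕h_j² − 1∕h′_j² → δ_∞` with `e^{−3M∕(2b√b)}·(1∕t² − 1∕t′²) ≤ δ_∞ ≤ 1∕t² − 1∕t′²` — two
trajectories with different infrared values keep, to leading order, a DEFINITE CONSTANT OFFSET of `1∕g²` in the ultraviolet. [folklore] -/
theorem tendsto_disc_of_monotone (hb : 0 < b)
    (hmono : ∀ u v : ℕ → ℝ, SeqBox γ u → SeqBox γ v → (∀ j, u j ≤ v j) → B u ≤ B v)
    (hB : ∀ u u' : ℕ → ℝ, SeqBox γ u → SeqBox γ u' → ∀ D : ℝ, (∀ j, |u j - u' j| ≤ D) → |B u - B u'| ≤ M * D)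
    (hM : 0 ≤ M) (hlo : ∀ u, SeqBox γ u → b ≤ B u) (ht : 0 < t) (htt' : t ≤ t') (ht'γ : t' ≤ γ)
    (hh : SeqBox γ h) (hh' : SeqBox γ h') (hf : MemFlow B t h) (hf' : MemFlow B t' h') :
    ∃ δ : ℝ, Tendsto (fun j => 1 / h j ^ 2 - 1 / h' j ^ 2) atTop (𝓝 δ) ∧
      Real.exp (-(3 * M / (2 * (b * Real.sqrt b)))) * (1 / t ^ 2 - 1 / t' ^ 2) ≤ δ ∧ δ ≤ 1 / t ^ 2 - 1 / t' ^ 2 := by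
  have hanti := disc_antitone_of_monotone hb hmono hB hM hlo ht htt' ht'γ hh hh' hf hf'
  have hlow : ∀ j, Real.exp (-(3 * M / (2 * (b * Real.sqrt b)))) * (1 / t ^ 2 - 1 / t' ^ 2) ≤ 1 / h j ^ 2 - 1 / h' j ^ 2 := by
    intro j
    rw [Real.exp_neg, inv_mul_le_iff₀ (Real.exp_pos _)]
    exact disc_zero_le_exp_mul_disc_of_monotone hb hmono hB hM hlo ht htt' ht'γ hh hh' hf hf' j
  have hbdd : BddBelow (range fun j => 1 / h j ^ 2 - 1 / h' j ^ 2) := ⟨_, by rintro _ ⟨j, rfl⟩; exact hlow j⟩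
  refine ⟨_, tendsto_atTop_ciInf hanti hbdd, le_ciInf hlow, ?_⟩
  exact (ciInf_le hbdd 0).trans (by rw [hf.1, hf'.1])

/-! ## §3 Antitone memory in a uniqueness regime: the discrepancy is non-decreasing — anti-screening -/

/-- **ANTI-SCREENING**: for a functional NON-INCREASING in the history with at most one box solution per pin (e.g. `M·γ ≤ 3√3·b`), pins `t ≤ t′` give a
NON-DECREASING discrepancy `δ_j ≤ δ_{j+1}` — the larger trajectory runs with the SMALLER β-function and falls further behind in `1∕g²`. [folklore] -/
theorem disc_le_disc_succ_of_antitone (hb : 0 < b)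
    (hanti : ∀ u v : ℕ → ℝ, SeqBox γ u → SeqBox γ v → (∀ j, u j ≤ v j) → B v ≤ B u)
    (hB : ∀ u u' : ℕ → ℝ, SeqBox γ u → SeqBox γ u' → ∀ D : ℝ, (∀ j, |u j - u' j| ≤ D) → |B u - B u'| ≤ M * D)
    (hM : 0 ≤ M) (hlo : ∀ u, SeqBox γ u → b ≤ B u)
    (huniq : ∀ p, 0 < p → p ≤ γ → ∀ u u' : ℕ → ℝ, SeqBox γ u → SeqBox γ u' → MemFlow B p u → MemFlow B p u' → u = u')
    (ht : 0 < t) (htt' : t ≤ t') (ht'γ : t' ≤ γ) (hh : SeqBox γ h) (hh' : SeqBox γ h') (hf : MemFlow B t h) (hf' : MemFlow B t' h')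
    (j : ℕ) : 1 / h j ^ 2 - 1 / h' j ^ 2 ≤ 1 / h (j + 1) ^ 2 - 1 / h' (j + 1) ^ 2 := by
  have hle : B (fun i => h' (j + 1 + i)) ≤ B (fun i => h (j + 1 + i)) :=
    hanti _ _ (seqBox_shift hh (j + 1)) (seqBox_shift hh' (j + 1))
      fun i => le_of_pin_le hb hB hM hlo huniq ht htt' ht'γ hh hh' hf hf' (j + 1 + i)
  rw [hf.2 j, hf'.2 j]; linarith

/-- So for antitone memory the discrepancy is a MONOTONE sequence … [folklore] -/
theorem disc_monotone_of_antitone (hb : 0 < b)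
    (hanti : ∀ u v : ℕ → ℝ, SeqBox γ u → SeqBox γ v → (∀ j, u j ≤ v j) → B v ≤ B u)
    (hB : ∀ u u' : ℕ → ℝ, SeqBox γ u → SeqBox γ u' → ∀ D : ℝ, (∀ j, |u j - u' j| ≤ D) → |B u - B u'| ≤ M * D)
    (hM : 0 ≤ M) (hlo : ∀ u, SeqBox γ u → b ≤ B u)
    (huniq : ∀ p, 0 < p → p ≤ γ → ∀ u u' : ℕ → ℝ, SeqBox γ u → SeqBox γ u' → MemFlow B p u → MemFlow B p u' → u = u')
    (ht : 0 < t) (htt' : t ≤ t') (ht'γ : t' ≤ γ) (hh : SeqBox γ h) (hh' : SeqBox γ h') (hf : MemFlow B t h) (hf' : MemFlow B t' h') :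
    Monotone fun j => 1 / h j ^ 2 - 1 / h' j ^ 2 :=
  monotone_nat_of_le_succ fun j => disc_le_disc_succ_of_antitone hb hanti hB hM hlo huniq ht htt' ht'γ hh hh' hf hf' j

/-- … bounded BELOW by its infrared value: `1∕t² − 1∕t′² ≤ 1∕h_j² − 1∕h′_j²` — the trajectories SEPARATE in the recursion variable. [folklore] -/
theorem disc_zero_le_disc_of_antitone (hb : 0 < b)
    (hanti : ∀ u v : ℕ → ℝ, SeqBox γ u → SeqBox γ v → (∀ j, u j ≤ v j) → B v ≤ B u)
    (hB : ∀ u u' : ℕ → ℝ, SeqBox γ u → SeqBox γ u' → ∀ D : ℝ, (∀ j, |u j - u' j| ≤ D) → |B u - B u'| ≤ M * D)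
    (hM : 0 ≤ M) (hlo : ∀ u, SeqBox γ u → b ≤ B u)
    (huniq : ∀ p, 0 < p → p ≤ γ → ∀ u u' : ℕ → ℝ, SeqBox γ u → SeqBox γ u' → MemFlow B p u → MemFlow B p u' → u = u')
    (ht : 0 < t) (htt' : t ≤ t') (ht'γ : t' ≤ γ) (hh : SeqBox γ h) (hh' : SeqBox γ h') (hf : MemFlow B t h) (hf' : MemFlow B t' h')
    (j : ℕ) : 1 / t ^ 2 - 1 / t' ^ 2 ≤ 1 / h j ^ 2 - 1 / h' j ^ 2 := by
  have := disc_monotone_of_antitone hb hanti hB hM hlo huniq ht htt' ht'γ hh hh' hf hf' (Nat.zero_le j)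
  simp only at this
  rwa [hf.1, hf'.1] at this

/-- ANTI-SCREENING ON THE CLOSED THRESHOLD: antitone memory with `M·γ ≤ 3√3·b` ((E38a)'s uniqueness), pins `t ≤ t′`: `1∕t² − 1∕t′² ≤ 1∕h_j² − 1∕h′_j²` at every
scale. [folklore] -/
theorem disc_zero_le_disc_of_antitone_zs_closed (hb : 0 < b)
    (hanti : ∀ u v : ℕ → ℝ, SeqBox γ u → SeqBox γ v → (∀ j, u j ≤ v j) → B v ≤ B u)
    (hB : ∀ u u' : ℕ → ℝ, SeqBox γ u → SeqBox γ u' → ∀ D : ℝ, (∀ j, |u j - u' j| ≤ D) → |B u - B u'| ≤ M * D)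
    (hM : 0 ≤ M) (hlo : ∀ u, SeqBox γ u → b ≤ B u) (hsmall : M * γ ≤ 3 * Real.sqrt 3 * b)
    (ht : 0 < t) (htt' : t ≤ t') (ht'γ : t' ≤ γ) (hh : SeqBox γ h) (hh' : SeqBox γ h') (hf : MemFlow B t h) (hf' : MemFlow B t' h')
    (j : ℕ) : 1 / t ^ 2 - 1 / t' ^ 2 ≤ 1 / h j ^ 2 - 1 / h' j ^ 2 :=
  disc_zero_le_disc_of_antitone hb hanti hB hM hlo
    (fun _ hp0 hpγ _ _ hu hu' hfu hfu' => memFlow_unique_zs_closed hB hM hp0 hpγ hb hlo hsmall hu hu' hfu hfu')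
    ht htt' ht'γ hh hh' hf hf' j

end Summit.QuantumFields.BalabanUV.Beta.EriceRemainderEnclosureHistoryAutonomyOrderScreening

end
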